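import Literature.Probability.RandomPlanarGeometry.ContinuousPathProjectionC
import Literature.Probability.RandomPlanarGeometry.SLESixMoebiusLocalization
import Literature.Probability.RandomPlanarGeometry.SLEScaleInvarianceProofs
import Literature.Probability.Process.PathRegularization
import Literature.Probability.RandomPlanarGeometry.SLESwallowingNearZero
import HarnessLib
import Literature.Probability.RandomPlanarGeometry.SLESixMoebiusLocalizationBounds
import Literature.Probability.RandomPlanarGeometry.SLESixMoebiusLocality
import Literature.Probability.RandomPlanarGeometry.SLEAdaptedProofs
import Literature.Probability.RandomPlanarGeometry.SLETwoPointFlowProofs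

/-!
# The intrinsic localising time of a real point under a driving function; the stopped trace class

Topic `Probability/RandomPlanarGeometry`. Definitions only (real, total), companions of
`SLESixMoebiusLocalization.lean` on the side of the IMAGE chain (G. F. Lawler, *Conformally
Invariant Processes in the Plane* (2005), §6.3, Thm. 6.13 / Prop. 6.14 for the Möbius map
`Φ_x(z) = xz/(z + x)`). Under the Möbius conjugation the pole data of the chain driven by
`W` — the gap `X = g(p) - W` of the pole `p = -x`, the jet `d₁ = g'(p)` and the original time —
are read off the image chain (driving function `U`, in capacity time `s`) as functionals of
the gap `X̂_s = ĝ_s(x) - U_s` of the tracked real point `x = Φ_x(∞)`: `d₁ = exp(-∫ 2/X̂²)`,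
`|X| = b d₁/|X̂|`, `b d₁/|X| = |X̂|`, original time `= ∫ (b d₁/X̂²)²` (`b = x²`;
`LoewnerMoebiusClock`: `exp_neg_integral_imageGap`, `integral_imageRate_eq`). The localising
box of `SLESixMoebiusLocalization.locTime` is symmetric under this dictionary, so the SAME exit
time is an intrinsic functional of the image driving function:

* (`regPath U` of `SLESwallowingNearZero.lean` — the measurable continuous modification of a raw
  real path, `pathRegularize`,
  recentred at `0`), the identity on continuous paths started at `0`;
* `pointGap y s U = realFlowStop (regPath U) y s` — the gap of the real point `y`;
  `pointWideExit` (exit of the gap from the band of level `2N`), `pointGapStop`,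
  `pointDeriv` (`= exp(-∫ 2/X̂²)`), `pointTime` (`= ∫ (b d/X̂²)²`), `pointRatio` (`= b d/|X̂|`);
* `pointLocTime y b n U` — the **intrinsic localising time**: first exit of
  `(X̂, b d/|X̂|, ∫(b d/X̂²)²)` from `{1/N < |X̂| < N} × (1/N, N) × (-1, N)`, guarded by the wide
  exit;
* `stopPath`, `stoppedClass` — the stopped continuous path `s ↦ γ(τ s)` in `C([0,1], ℂ)` and its
  curve class; `projC` (a measurable projection onto continuous complex paths, chosen from
  `exists_measurable_continuousMap_projC`), `traceFun` (a measurable trace functional, chosen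
  from `Loewner.exists_measurable_eq_trace_of_continuous`);
* `stoppedTraceClass y b n U` — the class of the trace of the chain driven by `U` stopped at
  `pointLocTime y b n U`, assembled measurably from the above.

All theorems (measurability; evaluation on continuous generated driving functions; the
dictionary `pointLocTime x x² n (image driver) = clock(locTime x n)`) are in the sequel files.

## References

* G. F. Lawler, *Conformally Invariant Processes in the Plane*, AMS (2005), §4.6.1, §6.3
  (Thm. 6.13, Prop. 6.14). [Lawler2005]
-/

noncomputable section

open MeasureTheory Set
open scoped NNReal unitInterval

namespace Literature.Probability.RandomPlanarGeometry

open scoped PathBorel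

namespace SLESixMoebius

open Literature.Probability.Process Literature.Analysis.FunctionSpaces

/-! ### Stopped continuous paths and their classes -/

/-- **The stopped continuous path** `s ↦ γ(τ s)`, `s ∈ [0, 1]`, as an element of `C([0,1], ℂ)`.
[folklore] -/
def stopPath (γ : C(ℝ≥0, ℂ)) (τ : ℝ≥0) : C(I, ℂ) :=
  ⟨fun s : I ↦ γ (((τ : ℝ) * s).toNNReal),
    γ.continuous.comp (continuous_real_toNNReal.comp (continuous_const.mul continuous_subtype_val))⟩

/-- **The curve class of the stopped continuous path** (`= stoppedPathClass id γ τ` of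
`SLESixMoebiusLocality.lean` for a continuous path). [folklore] -/
def stoppedClass (γ : C(ℝ≥0, ℂ)) (τ : ℝ≥0) : CurveClass ℂ :=
  CurveClass.mk (Curve.mk (stopPath γ τ))

/-- A measurable projection of raw complex paths onto continuous paths, the identity on
continuous paths (a choice from `exists_measurable_continuousMap_projC`). [folklore] -/
def projC : (ℝ≥0 → ℂ) → C(ℝ≥0, ℂ) :=
  Classical.choose exists_measurable_continuousMap_projC

/-- A measurable Loewner trace functional, equal to `Loewner.trace U` for every continuous `U`
(a choice from `Loewner.exists_measurable_eq_trace_of_continuous`).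
[cite: RohdeSchramm2005, §3 p. 896] -/
def traceFun : (ℝ≥0 → ℝ) → ℝ≥0 → ℂ :=
  Classical.choose Loewner.exists_measurable_eq_trace_of_continuous

/-! ### The gap of a real point under a (regularised) driving function

The raw path `U` is read through the continuous modification `regPath U` of
`SLESwallowingNearZero.lean` (`pathRegularize U - pathRegularize U 0`). -/

/-- **The gap of the real point `y`** under the chain driven by (the regularisation of) `U`:
`X̂_s = g_s(y) - U_s`, frozen at `0` from the swallowing time on (`Loewner.realFlowStop`).
[cite: Lawler2005, §6.2 eq. (6.3)] -/
def pointGap (y : ℝ) : ℝ≥0 → (ℝ≥0 → ℝ) → ℝ := fun s U ↦ Loewner.realFlowStop (regPath U) y s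

/-- The exit of the gap of `y` from the wide band of level `2N` (`1/(2N) < |X̂| < 2N`; the gap has
the sign of `y`, so the band is `(bandLo (-y), bandHi (-y))` at level index `2n + 1`). [folklore] -/
def pointWideExit (y : ℝ) (n : ℕ) : (ℝ≥0 → ℝ) → WithTop ℝ≥0 :=
  Process.exitTime (pointGap y) (bandLo (-y) (2 * n + 1)) (bandHi (-y) (2 * n + 1))

/-- The gap of `y` stopped at its wide exit. [folklore] -/
def pointGapStop (y : ℝ) (n : ℕ) : ℝ≥0 → (ℝ≥0 → ℝ) → ℝ :=
  stoppedProcess (pointGap y) (pointWideExit y n)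

/-- **The jet of the tracked point** `d(s) = exp(-∫₀ˢ 2/X̂_r² dr)` (`= ĝ_s'(y)`; integrand killed
after the wide exit). [cite: Lawler2005, §4.6.1] -/
def pointDeriv (y : ℝ) (n : ℕ) : ℝ≥0 → (ℝ≥0 → ℝ) → ℝ := fun s U ↦
  Real.exp (-timeIntegral (trunc (pointWideExit y n) fun r U ↦ 2 / pointGapStop y n r U ^ 2) s U)

/-- **The original-time functional** `∫₀ˢ (b d(r)/X̂_r²)² dr` (for the Möbius image chain this
is the time of the original chain, `MoebiusPole.integral_imageRate_eq`; integrand killed after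
the wide exit). [cite: Lawler2005, §6.3] -/
def pointTime (y b : ℝ) (n : ℕ) : ℝ≥0 → (ℝ≥0 → ℝ) → ℝ :=
  timeIntegral (trunc (pointWideExit y n)
    fun r U ↦ (b * pointDeriv y n r U / pointGapStop y n r U ^ 2) ^ 2)

/-- **The ratio** `b d(s)/|X̂_s|` (for the Möbius image chain: the size `|X|` of the gap of the
pole of the original chain). [cite: Lawler2005, §6.3] -/
def pointRatio (y b : ℝ) (n : ℕ) : ℝ≥0 → (ℝ≥0 → ℝ) → ℝ := fun s U ↦
  b * pointDeriv y n s U / |pointGapStop y n s U|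

/-- **The intrinsic localising time** of the point `y` under the driving function `U` (level
`N = n + 1`, coefficient `b`): the first exit of `(X̂, b d/|X̂|, ∫ (b d/X̂²)²)` from
`{1/N < |X̂| < N} × (1/N, N) × (-1, N)`, guarded by the wide exit. [folklore] -/
def pointLocTime (y b : ℝ) (n : ℕ) (U : ℝ≥0 → ℝ) : WithTop ℝ≥0 :=
  min (pointWideExit y n U)
    (min (Process.exitTime (pointGapStop y n) (bandLo (-y) n) (bandHi (-y) n) U)
      (min (Process.exitTime (pointRatio y b n) (1 / level n) (level n) U)
        (Process.exitTime (pointTime y b n) (-1) (level n) U)))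

/-! ### The stopped trace class functional -/

/-- **The curve class of the trace stopped at the intrinsic localising time**, assembled
measurably: the trace functional `traceFun` of the regularised driving function, projected onto
continuous paths (`projC`), stopped at `pointLocTime` (junk `0` if infinite). For a continuous
`U` with `U 0 = 0` whose chain is generated by a curve `γ̂` this is the class of
`γ̂|[0, pointLocTime y b n U]` (sequel). [folklore] -/
def stoppedTraceClass (y b : ℝ) (n : ℕ) (U : ℝ≥0 → ℝ) : CurveClass ℂ :=
  stoppedClass (projC (traceFun (regPath U))) ((pointLocTime y b n U).untopD 0)

end SLESixMoebius

end Literature.Probability.RandomPlanarGeometry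

end


/-!
# The intrinsic localising time and the stopped trace class: regularity, measurability, evaluation

Topic `Probability/RandomPlanarGeometry`; theorems only, about the definitions of
`SLESixMoebiusPointFunctional.lean` (the image-side, intrinsic twin of the localisation of
`SLESixMoebiusLocalization.lean`; G. F. Lawler (2005), §6.3, Thm. 6.13 / Prop. 6.14):

* `stoppedClass`: `continuous_stoppedClass₂` (joint continuity in (path, time)),
  `stoppedPathClass_eq_stoppedClass` (it is the `stoppedPathClass` of
  `SLESixMoebiusLocality.lean` on continuous paths), `mk_eq_stoppedClass_of_monotone` (a monotone
  continuous reparametrisation of `γ|[0, τ]` has the same class);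
* `projC`, `traceFun`: measurability and the defining identities on continuous arguments;
* `regPath`: continuity, `regPath U 0 = 0`, `regPath U = U` for continuous `U` with `U 0 = 0`,
  measurability;
* the processes `pointGap`, `pointGapStop`, `pointDeriv`, `pointTime`, `pointRatio` on the raw
  path space with the constant filtration: continuous paths, adaptedness; `pointLocTime` is a
  stopping time, hence measurable; `measurable_stoppedTraceClass`;
* `stoppedTraceClass_eq_of_continuous` — for a continuous `U` with `U 0 = 0` whose trace is
  continuous, `stoppedTraceClass y b n U = stoppedPathClass id (trace U) (pointLocTime y b n U)`.

## References

* G. F. Lawler, *Conformally Invariant Processes in the Plane*, AMS (2005), §6.3. [Lawler2005]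
-/

noncomputable section

open MeasureTheory Filter Set Function
open scoped NNReal ENNReal Topology unitInterval

namespace Literature.Probability.RandomPlanarGeometry

open scoped PathBorel

namespace SLESixMoebius

open Literature.Probability.Process Literature.Analysis.FunctionSpaces

/-! ### Stopped classes -/

/-- Unfolding of `stopPath`. [folklore] -/
theorem stopPath_apply (γ : C(ℝ≥0, ℂ)) (τ : ℝ≥0) (s : I) :
    stopPath γ τ s = γ (((τ : ℝ) * s).toNNReal) := rfl

/-- **Joint continuity of the stopped class** in (path, time). [folklore] -/
theorem continuous_stoppedClass₂ :
    Continuous fun q : C(ℝ≥0, ℂ) × ℝ≥0 ↦ stoppedClass q.1 q.2 :=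
  continuous_mk_stopPath

/-- Continuity of the stopped class in the time, for a fixed continuous path. [folklore] -/
theorem continuous_stoppedClass (γ : C(ℝ≥0, ℂ)) : Continuous fun τ : ℝ≥0 ↦ stoppedClass γ τ :=
  continuous_stoppedClass₂.comp (continuous_const.prodMk continuous_id)

/-- The stopped class is jointly measurable. [folklore] -/
theorem measurable_stoppedClass₂ :
    Measurable fun q : C(ℝ≥0, ℂ) × ℝ≥0 ↦ stoppedClass q.1 q.2 :=
  continuous_stoppedClass₂.measurable

/-- **`stoppedPathClass F γ τ = stoppedClass (F ∘ γ) τ`** whenever `F ∘ γ` is continuous (the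
continuous branch of `stoppedPathClass`). [folklore] -/
theorem stoppedPathClass_eq_stoppedClass {F : ℂ → ℂ} {γ : ℝ≥0 → ℂ} (h : Continuous (F ∘ γ))
    (τ : ℝ≥0) : stoppedPathClass F γ τ = stoppedClass ⟨F ∘ γ, h⟩ τ := by
  have hc : Continuous (fun s : I ↦ F (γ (((τ : ℝ) * s).toNNReal))) :=
    h.comp (continuous_real_toNNReal.comp (continuous_const.mul continuous_subtype_val))
  rw [stoppedPathClass_eq hc]
  rfl

/-- For a continuous path, `stoppedPathClass id γ τ = stoppedClass γ τ`. [folklore] -/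
theorem stoppedPathClass_id_eq_stoppedClass (γ : C(ℝ≥0, ℂ)) (τ : ℝ≥0) :
    stoppedPathClass id γ τ = stoppedClass γ τ :=
  stoppedPathClass_eq_stoppedClass (F := id) (γ := γ) γ.continuous τ

/-- **Reparametrisation invariance of the stopped class.** If `c : [0,1] → ℂ` is a curve with
`c s = γ(φ s)` for a continuous monotone `φ : ℝ → ℝ` with `φ 0 = 0`, `φ 1 = τ`, then
`mk c = stoppedClass γ τ` (two monotone traversals of the arc `γ|[0, τ]`,
`Curve.reparamDist_eq_zero_of_monotone'`). [folklore] -/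
theorem mk_eq_stoppedClass_of_monotone (γ : C(ℝ≥0, ℂ)) (τ : ℝ≥0) {φ : ℝ → ℝ}
    (hφc : Continuous φ) (hφm : Monotone φ) (hφ0 : φ 0 = 0) (hφ1 : φ 1 = τ) {c : Curve ℂ}
    (hc : ∀ s : I, c s = γ (φ s).toNNReal) : CurveClass.mk c = stoppedClass γ τ := by
  unfold stoppedClass
  rw [CurveClass.mk_eq_mk]
  set q : ℝ → ℝ := fun r ↦ max 0 (min 1 r) with hq
  have hV : ContinuousOn (fun r : ℝ ↦ γ r.toNNReal) (Icc 0 τ) :=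
    (γ.continuous.comp continuous_real_toNNReal).continuousOn
  refine Curve.reparamDist_eq_zero_of_monotone' (m := (τ : ℝ)) τ.2 hV (h₁ := φ ∘ q)
    (h₂ := fun r ↦ (τ : ℝ) * q r) (hφc.comp continuous_clampUnit)
    (continuous_const.mul continuous_clampUnit) (hφm.comp monotone_clampUnit)
    (fun a b hab ↦ mul_le_mul_of_nonneg_left (monotone_clampUnit hab) τ.2) ?_ ?_ ?_ ?_ ?_ ?_
  · simp [hq, hφ0]
  · simp [hq]
  · simp only [comp_apply, hq]; rw [min_self, max_eq_right zero_le_one, hφ1]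
  · simp only [hq]; rw [min_self, max_eq_right zero_le_one, mul_one]
  · intro t; simp only [comp_apply, hq, clampUnit_of_mem t]; exact hc t
  · intro t; simp only [hq, clampUnit_of_mem t]; rfl

/-! ### The chosen measurable maps -/

/-- `projC` is measurable. [folklore] -/
theorem measurable_projC : Measurable projC :=
  (Classical.choose_spec exists_measurable_continuousMap_projC).1

/-- `projC` is the identity on continuous paths. [folklore] -/
theorem projC_coe (W : C(ℝ≥0, ℂ)) : projC W = W :=
  (Classical.choose_spec exists_measurable_continuousMap_projC).2 W

/-- `projC` of a continuous function, as a function, is the function. [folklore] -/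
theorem coe_projC_of_continuous {w : ℝ≥0 → ℂ} (hw : Continuous w) : ⇑(projC w) = w := by
  have h := projC_coe ⟨w, hw⟩
  exact congrArg DFunLike.coe h

/-- `traceFun` is measurable. [folklore] -/
theorem measurable_traceFun : Measurable traceFun :=
  (Classical.choose_spec Loewner.exists_measurable_eq_trace_of_continuous).1

/-- `traceFun U = trace U` for continuous `U`. [folklore] -/
theorem traceFun_eq_trace {U : ℝ≥0 → ℝ} (hU : Continuous U) : traceFun U = Loewner.trace U :=
  (Classical.choose_spec Loewner.exists_measurable_eq_trace_of_continuous).2 U hU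

/-! ### The regularised path -/

/-- The regularisation `regPath` (of `SLESwallowingNearZero.lean`) is measurable into the product
σ-algebra. [folklore] -/
theorem measurable_regPath_pi : Measurable (regPath : (ℝ≥0 → ℝ) → ℝ≥0 → ℝ) :=
  measurable_pi_lambda _ measurable_regPath

/-! ### The processes on the raw path space -/

section Processes

variable {y b : ℝ} {n : ℕ}

/-- The constant filtration of the raw path space. [folklore] -/
theorem adapted_const_iff {u : ℝ≥0 → (ℝ≥0 → ℝ) → ℝ} :
    Adapted (Filtration.const ℝ≥0 (MeasurableSpace.pi (m := fun _ : ℝ≥0 ↦ (inferInstance :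
      MeasurableSpace ℝ))) le_rfl) u ↔ ∀ t, Measurable (u t) :=
  ⟨fun h t ↦ h t, fun h t ↦ h t⟩

/-- **The gap of a real point is measurable in the raw path** at each time (the real Loewner flow
is a measurable functional of the continuous regularised path, `Loewner.measurable_realFlowTrunc`,
with the reflection `W ↦ -W` for negative points). [folklore] -/
theorem measurable_pointGap (hy : y ≠ 0) (s : ℝ≥0) : Measurable (pointGap y s) := by
  rcases lt_or_gt_of_ne hy with hneg | hpos
  · have h := Loewner.measurable_realFlowTrunc (W := fun U : ℝ≥0 → ℝ ↦ fun t ↦ -regPath U t)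
      (t := s) (fun U ↦ (continuous_regPath U).neg) (fun U ↦ by simp [regPath_zero])
      (fun r _ ↦ (measurable_regPath r).neg) (neg_pos.2 hneg)
    have hfun : pointGap y s = fun U ↦ -(if (s : WithTop ℝ≥0) <
        Loewner.swallowingTime (fun t ↦ -regPath U t) ((-y : ℝ) : ℂ) then
        (Loewner.map (fun t ↦ -regPath U t) s ((-y : ℝ) : ℂ)).re - -regPath U s else 0) := by
      funext U
      have h1 := Loewner.realFlowStop_neg_neg (continuous_regPath U) y s
      unfold pointGap
      rw [show Loewner.realFlowStop (regPath U) y s =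
        -Loewner.realFlowStop (fun t ↦ -regPath U t) (-y) s by rw [h1, neg_neg]]
      rfl
    rw [hfun]
    exact h.neg
  · exact Loewner.measurable_realFlowTrunc (W := fun U : ℝ≥0 → ℝ ↦ regPath U) (t := s)
      continuous_regPath regPath_zero (fun r _ ↦ measurable_regPath r) hpos

/-- The gap of `y ≠ 0` has continuous paths (every raw path). [folklore] -/
theorem continuous_pointGap (hy : y ≠ 0) (U : ℝ≥0 → ℝ) : Continuous fun s ↦ pointGap y s U :=
  Loewner.continuous_realFlowStop_of_ne (continuous_regPath U) (by rwa [regPath_zero])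

/-- The gap starts at `y`. [folklore] -/
theorem pointGap_zero (hy : y ≠ 0) (U : ℝ≥0 → ℝ) : pointGap y 0 U = y := by
  unfold pointGap
  rw [Loewner.realFlowStop_zero_of_ne (continuous_regPath U) (by rwa [regPath_zero]),
    regPath_zero, sub_zero]

/-- The gap is adapted to the constant filtration. [folklore] -/
theorem adapted_pointGap (hy : y ≠ 0) :
    Adapted (Filtration.const ℝ≥0 (MeasurableSpace.pi (m := fun _ : ℝ≥0 ↦ (inferInstance :
      MeasurableSpace ℝ))) le_rfl) (pointGap y) :=
  adapted_const_iff.2 (measurable_pointGap hy)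

/-- The gap is progressively measurable for the constant filtration. [folklore] -/
theorem isStronglyProgressive_pointGap (hy : y ≠ 0) :
    IsStronglyProgressive (Filtration.const ℝ≥0 (MeasurableSpace.pi (m := fun _ : ℝ≥0 ↦
      (inferInstance : MeasurableSpace ℝ))) le_rfl) (pointGap y) :=
  StronglyAdapted.isStronglyProgressive_of_continuous
    (fun t ↦ (measurable_pointGap hy t).stronglyMeasurable) (continuous_pointGap hy)

/-- The wide exit is a stopping time. [folklore] -/
theorem isStoppingTime_pointWideExit (hy : y ≠ 0) :
    IsStoppingTime (Filtration.const ℝ≥0 (MeasurableSpace.pi (m := fun _ : ℝ≥0 ↦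
      (inferInstance : MeasurableSpace ℝ))) le_rfl) (pointWideExit y n) :=
  Process.isStoppingTime_exitTime (adapted_pointGap hy) (continuous_pointGap hy)

/-- `y` lies strictly inside the wide band when `1/N < |y| < N`. [folklore] -/
theorem mem_Ioo_wideBand (hy1 : 1 / level n < |y|) (hy2 : |y| < level n) :
    y ∈ Ioo (bandLo (-y) (2 * n + 1)) (bandHi (-y) (2 * n + 1)) := by
  have hN : 0 < level n := by unfold level; positivity
  have hlev : level (2 * n + 1) = 2 * level n := by unfold level; push_cast; ring
  have h := neg_mem_Ioo_band (x := -y) (n := 2 * n + 1) (by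
    rw [abs_neg, hlev]
    calc 1 / (2 * level n) ≤ 1 / level n := by
          apply one_div_le_one_div_of_le hN; linarith
      _ < |y| := hy1) (by rw [abs_neg, hlev]; linarith)
  rwa [neg_neg] at h

/-- The stopped gap stays in the closed wide band (`1/N < |y| < N`). [folklore] -/
theorem pointGapStop_mem (hy1 : 1 / level n < |y|) (hy2 : |y| < level n) (s : ℝ≥0)
    (U : ℝ≥0 → ℝ) :
    pointGapStop y n s U ∈ Icc (bandLo (-y) (2 * n + 1)) (bandHi (-y) (2 * n + 1)) := by
  have hy := ne_zero_of_inv_level_lt hy1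
  have h0 : pointGap y 0 U ∈ Ioo (bandLo (-y) (2 * n + 1)) (bandHi (-y) (2 * n + 1)) := by
    rw [pointGap_zero hy]; exact mem_Ioo_wideBand hy1 hy2
  exact Process.stoppedProcess_exitTime_mem_Icc (continuous_pointGap hy U) h0 s

/-- The stopped gap never vanishes. [folklore] -/
theorem pointGapStop_ne_zero (hy1 : 1 / level n < |y|) (hy2 : |y| < level n) (s : ℝ≥0)
    (U : ℝ≥0 → ℝ) : pointGapStop y n s U ≠ 0 :=
  ne_zero_of_mem_band (pointGapStop_mem hy1 hy2 s U)

/-- The stopped gap has continuous paths. [folklore] -/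
theorem continuous_pointGapStop (hy : y ≠ 0) (U : ℝ≥0 → ℝ) :
    Continuous fun s ↦ pointGapStop y n s U :=
  Process.continuous_stoppedProcess_path (continuous_pointGap hy U) _

/-- The stopped gap is progressively measurable. [folklore] -/
theorem isStronglyProgressive_pointGapStop (hy : y ≠ 0) :
    IsStronglyProgressive (Filtration.const ℝ≥0 (MeasurableSpace.pi (m := fun _ : ℝ≥0 ↦
      (inferInstance : MeasurableSpace ℝ))) le_rfl) (pointGapStop y n) :=
  (isStronglyProgressive_pointGap hy).stoppedProcess (isStoppingTime_pointWideExit hy)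

/-- The jet has continuous paths. [folklore] -/
theorem continuous_pointDeriv (hy1 : 1 / level n < |y|) (hy2 : |y| < level n) (U : ℝ≥0 → ℝ) :
    Continuous fun s ↦ pointDeriv y n s U := by
  have hy := ne_zero_of_inv_level_lt hy1
  unfold pointDeriv
  refine Real.continuous_exp.comp (continuous_timeIntegral fun t ↦ integrableOn_trunc ?_).neg
  have hc : Continuous fun r : ℝ ↦ 2 / pointGapStop y n r.toNNReal U ^ 2 :=
    continuous_const.div (((continuous_pointGapStop hy U).comp continuous_real_toNNReal).pow 2)
      fun r ↦ pow_ne_zero 2 (pointGapStop_ne_zero hy1 hy2 _ U)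
  exact hc.continuousOn.integrableOn_compact isCompact_Icc

/-- The jet is progressively measurable. [folklore] -/
theorem isStronglyProgressive_pointDeriv (hy : y ≠ 0) :
    IsStronglyProgressive (Filtration.const ℝ≥0 (MeasurableSpace.pi (m := fun _ : ℝ≥0 ↦
      (inferInstance : MeasurableSpace ℝ))) le_rfl) (pointDeriv y n) := by
  have hst := isStoppingTime_pointWideExit (n := n) hy
  have hr : IsStronglyProgressive (Filtration.const ℝ≥0 (MeasurableSpace.pi (m := fun _ : ℝ≥0 ↦
      (inferInstance : MeasurableSpace ℝ))) le_rfl) (trunc (pointWideExit y n)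
      fun r U ↦ 2 / pointGapStop y n r U ^ 2) :=
    isStronglyProgressive_trunc (IsStronglyProgressive.comp_measurable₂
      (isStronglyProgressive_pointGapStop hy) (F := fun _ v ↦ 2 / v ^ 2)
      (measurable_const.div (measurable_snd.pow_const 2))) fun t ↦ hst.measurableSet_lt t
  unfold pointDeriv
  exact IsStronglyProgressive.continuous_comp (IsStronglyProgressive.continuous_comp
    (isStronglyProgressive_timeIntegral hr) continuous_neg) Real.continuous_exp

/-- The jet is positive. [folklore] -/
theorem pointDeriv_pos (s : ℝ≥0) (U : ℝ≥0 → ℝ) : 0 < pointDeriv y n s U := Real.exp_pos _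

/-- The un-killed rate of the original-time functional has continuous paths. [folklore] -/
theorem continuous_pointTimeRate (hy1 : 1 / level n < |y|) (hy2 : |y| < level n)
    (U : ℝ≥0 → ℝ) :
    Continuous fun r ↦ (b * pointDeriv y n r U / pointGapStop y n r U ^ 2) ^ 2 := by
  have hy := ne_zero_of_inv_level_lt hy1
  exact ((continuous_const.mul (continuous_pointDeriv hy1 hy2 U)).div
    ((continuous_pointGapStop hy U).pow 2) fun r ↦ pow_ne_zero 2
      (pointGapStop_ne_zero hy1 hy2 r U)).pow 2

/-- The original-time functional has continuous paths. [folklore] -/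
theorem continuous_pointTime (hy1 : 1 / level n < |y|) (hy2 : |y| < level n) (U : ℝ≥0 → ℝ) :
    Continuous fun s ↦ pointTime y b n s U :=
  continuous_timeIntegral fun _ ↦ integrableOn_trunc
    (((continuous_pointTimeRate hy1 hy2 U).comp
      continuous_real_toNNReal).continuousOn.integrableOn_compact isCompact_Icc)

/-- The original-time functional is progressively measurable. [folklore] -/
theorem isStronglyProgressive_pointTime (hy : y ≠ 0) :
    IsStronglyProgressive (Filtration.const ℝ≥0 (MeasurableSpace.pi (m := fun _ : ℝ≥0 ↦
      (inferInstance : MeasurableSpace ℝ))) le_rfl) (pointTime y b n) := by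
  have hst := isStoppingTime_pointWideExit (n := n) hy
  unfold pointTime
  exact isStronglyProgressive_timeIntegral (isStronglyProgressive_trunc
    (isStronglyProgressive_comp₂ (isStronglyProgressive_pointDeriv hy)
      (isStronglyProgressive_pointGapStop hy) (φ := fun d v ↦ (b * d / v ^ 2) ^ 2)
      (((measurable_fst.const_mul _).div (measurable_snd.pow_const 2)).pow_const 2))
    fun t ↦ hst.measurableSet_lt t)

/-- The ratio has continuous paths. [folklore] -/
theorem continuous_pointRatio (hy1 : 1 / level n < |y|) (hy2 : |y| < level n) (U : ℝ≥0 → ℝ) :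
    Continuous fun s ↦ pointRatio y b n s U := by
  have hy := ne_zero_of_inv_level_lt hy1
  unfold pointRatio
  exact (continuous_const.mul (continuous_pointDeriv hy1 hy2 U)).div
    (continuous_abs.comp (continuous_pointGapStop hy U))
    fun s ↦ abs_ne_zero.2 (pointGapStop_ne_zero hy1 hy2 s U)

/-- The ratio is progressively measurable. [folklore] -/
theorem isStronglyProgressive_pointRatio (hy : y ≠ 0) :
    IsStronglyProgressive (Filtration.const ℝ≥0 (MeasurableSpace.pi (m := fun _ : ℝ≥0 ↦
      (inferInstance : MeasurableSpace ℝ))) le_rfl) (pointRatio y b n) :=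
  isStronglyProgressive_comp₂ (isStronglyProgressive_pointDeriv hy)
    (isStronglyProgressive_pointGapStop hy) (φ := fun d v ↦ b * d / |v|)
    ((measurable_fst.const_mul _).div measurable_snd.abs)

/-- **The intrinsic localising time is a stopping time** of the constant filtration of the raw
path space (`1/N < |y| < N`). [folklore] -/
theorem isStoppingTime_pointLocTime (hy1 : 1 / level n < |y|) (hy2 : |y| < level n) :
    IsStoppingTime (Filtration.const ℝ≥0 (MeasurableSpace.pi (m := fun _ : ℝ≥0 ↦
      (inferInstance : MeasurableSpace ℝ))) le_rfl) (pointLocTime y b n) := by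
  have hy := ne_zero_of_inv_level_lt hy1
  have h1 := isStoppingTime_pointWideExit (n := n) hy
  have h2 := Process.isStoppingTime_exitTime (a := bandLo (-y) n) (b := bandHi (-y) n)
    (fun t ↦ ((isStronglyProgressive_pointGapStop (n := n) hy).stronglyAdapted t).measurable)
    (continuous_pointGapStop hy)
  have h3 := Process.isStoppingTime_exitTime (a := 1 / level n) (b := level n)
    (fun t ↦ ((isStronglyProgressive_pointRatio (b := b) (n := n) hy).stronglyAdapted t).measurable)
    (continuous_pointRatio hy1 hy2)
  have h4 := Process.isStoppingTime_exitTime (a := (-1 : ℝ)) (b := level n)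
    (fun t ↦ ((isStronglyProgressive_pointTime (b := b) (n := n) hy).stronglyAdapted t).measurable)
    (continuous_pointTime hy1 hy2)
  exact h1.min (h2.min (h3.min h4))

/-- The intrinsic localising time is measurable. [folklore] -/
theorem measurable_pointLocTime (hy1 : 1 / level n < |y|) (hy2 : |y| < level n) :
    Measurable (pointLocTime y b n) :=
  (isStoppingTime_pointLocTime hy1 hy2).measurable'

/-- **The stopped trace class functional is measurable** on the raw path space. [folklore] -/
theorem measurable_stoppedTraceClass (hy1 : 1 / level n < |y|) (hy2 : |y| < level n) :
    Measurable (stoppedTraceClass y b n) := by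
  have h1 : Measurable fun U : ℝ≥0 → ℝ ↦ projC (traceFun (regPath U)) :=
    measurable_projC.comp (measurable_traceFun.comp measurable_regPath_pi)
  have h2 : Measurable fun U : ℝ≥0 → ℝ ↦ (pointLocTime y b n U).untopD 0 :=
    (measurable_pointLocTime hy1 hy2).untopD 0
  exact measurable_stoppedClass₂.comp (h1.prodMk h2)

end Processes

/-! ### Evaluation on continuous driving functions -/

/-- **On a continuous driving function started at `0` whose trace is continuous**, the
functional is the class of the stopped trace:
`stoppedTraceClass y b n U = stoppedPathClass id (trace U) (pointLocTime y b n U)`. [folklore] -/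
theorem stoppedTraceClass_eq_of_continuous {y b : ℝ} {n : ℕ} {U : ℝ≥0 → ℝ} (hU : Continuous U)
    (h0 : U 0 = 0) (htr : Continuous (Loewner.trace U)) :
    stoppedTraceClass y b n U =
      stoppedPathClass id (Loewner.trace U) ((pointLocTime y b n U).untopD 0) := by
  unfold stoppedTraceClass
  rw [regPath_eq_self hU h0, traceFun_eq_trace hU]
  have h : projC (Loewner.trace U) = ⟨Loewner.trace U, htr⟩ := projC_coe ⟨_, htr⟩
  rw [h]
  exact (stoppedPathClass_id_eq_stoppedClass ⟨_, htr⟩ _).symm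

end SLESixMoebius

end Literature.Probability.RandomPlanarGeometry

end


/-!
# The localising times exhaust the swallowing time of the pole (resp. of the tracked point)

Topic `Probability/RandomPlanarGeometry`; theorems only. For the localisation of
`SLESixMoebiusLocalization.lean` (pole `p = -x` of the Möbius map `Φ_x`, chain of `√6 B`) and its
intrinsic twin `pointLocTime` of `SLESixMoebiusPointFunctional.lean` (tracked point `y` under a
continuous driving function), the localising times of level `N = n + 1` increase to the
swallowing time as `N → ∞` (G. F. Lawler (2005), §6.3: the computation of Thm. 6.13 is valid "for
`t < t₀`", `t₀` the time at which `γ*` disconnects the target; Prop. 6.14). Deterministic,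
pathwise statements:

* `realFlowStop_sign` — the frozen real flow of `y ≠ W₀` keeps the sign of `y - W₀` before the
  swallowing time, and does not vanish there;
* `coe_lt_locTime_of_forall`, `locTime_lt_swallowingTime`, `tendsto_locTime` — if on `[0, t]`
  the gap stays in the open band and the ratio in `(1/N, N)` (and `t < N`) then `t < ρ_n`; the
  localising time is before the swallowing time `T_{-x}`; and `ρ_n → T_{-x}` whenever the latter
  is finite (compactness bounds on `[0, t]`, `t < T_{-x}`);
* `coe_lt_pointLocTime_of_forall`, `pointLocTime_le_of_exists`, `pointLocTime_lt_swallowingTime`,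
  `tendsto_pointLocTime` — the same for the intrinsic localising time of a point `y` under a
  continuous driving function started at `0`: before `T_y`, and `→ T_y` when finite (the exit of
  the gap from the wide band happens before `T_y` because the gap comes arbitrarily close to `0`
  before `T_y`, `IsSolution.exists_norm_sub_lt`).

## References

* G. F. Lawler, *Conformally Invariant Processes in the Plane*, AMS (2005), §4.1, §6.3.
  [Lawler2005]
-/

noncomputable section

open MeasureTheory Filter Set Function
open scoped NNReal ENNReal Topology

namespace Literature.Probability.RandomPlanarGeometry

namespace SLESixMoebius

open Loewner Literature.Probability.Process Literature.Analysis.FunctionSpaces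

/-! ### Sign and non-vanishing of the frozen real flow before the swallowing time -/

/-- Before the swallowing time, the frozen flow of a point to the right of the driving point is
positive. [cite: Lawler2005, Ch. 4 §4.1] -/
theorem realFlowStop_pos_of_lt {W : ℝ≥0 → ℝ} (hW : Continuous W) {y : ℝ} (hy : W 0 < y) {t : ℝ≥0}
    (ht : (t : WithTop ℝ≥0) < swallowingTime W y) : 0 < realFlowStop W y t := by
  rw [realFlowStop_of_lt ht]; exact realFlow_pos hW hy ht

/-- Before the swallowing time, the frozen flow of a point to the left of the driving point is
negative (reflection `W ↦ -W`). [cite: Lawler2005, Ch. 4 §4.1] -/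
theorem realFlowStop_neg_of_lt {W : ℝ≥0 → ℝ} (hW : Continuous W) {y : ℝ} (hy : y < W 0) {t : ℝ≥0}
    (ht : (t : WithTop ℝ≥0) < swallowingTime W y) : realFlowStop W y t < 0 := by
  have h1 := realFlowStop_neg_neg hW y t
  have ht' : (t : WithTop ℝ≥0) < swallowingTime (fun s ↦ -W s) ((-y : ℝ) : ℂ) := by
    rw [swallowingTime_neg_ofReal]; exact ht
  have hpos := realFlowStop_pos_of_lt (W := fun s ↦ -W s) hW.neg (by simpa using neg_lt_neg hy) ht'
  rw [h1] at hpos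
  linarith

/-- Before the swallowing time the frozen flow of `y ≠ W₀` does not vanish. [folklore] -/
theorem realFlowStop_ne_zero_of_lt {W : ℝ≥0 → ℝ} (hW : Continuous W) {y : ℝ} (hy : y ≠ W 0)
    {t : ℝ≥0} (ht : (t : WithTop ℝ≥0) < swallowingTime W y) : realFlowStop W y t ≠ 0 := by
  rcases lt_or_gt_of_ne hy with h | h
  · exact (realFlowStop_neg_of_lt hW h ht).ne
  · exact (realFlowStop_pos_of_lt hW h ht).ne'

/-! ### Compactness bounds for a continuous positive function on `[0, t]` -/

/-- A continuous function, positive on `[0, t]`, is bounded below by a positive constant and above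
there. [folklore] -/
theorem exists_pos_bounds_of_continuous {f : ℝ≥0 → ℝ} (hf : Continuous f) (t : ℝ≥0)
    (hpos : ∀ s ≤ t, 0 < f s) : ∃ m M : ℝ, 0 < m ∧ ∀ s ≤ t, m ≤ f s ∧ f s ≤ M := by
  have hK : IsCompact (Icc (0 : ℝ≥0) t) := isCompact_Icc
  have hne : (Icc (0 : ℝ≥0) t).Nonempty := ⟨0, left_mem_Icc.2 bot_le⟩
  obtain ⟨s₀, hs₀, hmin⟩ := hK.exists_isMinOn (f := f) hne (hf.continuousOn (s := Icc 0 t))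
  obtain ⟨s₁, hs₁, hmax⟩ := hK.exists_isMaxOn (f := f) hne (hf.continuousOn (s := Icc 0 t))
  refine ⟨f s₀, f s₁, hpos s₀ hs₀.2, fun s hs ↦ ⟨hmin ⟨bot_le, hs⟩, hmax ⟨bot_le, hs⟩⟩⟩

/-! ### The original side: `locTime x n ω → T_{-x}` -/

section Original

variable {x : ℝ} {n : ℕ}

/-- Unfolding: the gap is the frozen real flow of `-x` under `√6 B(ω)`. [folklore] -/
theorem gap_eq (x : ℝ) (s : ℝ≥0) (ω : ℝ≥0 → ℝ) : gap x s ω = realFlowStop (sleDriving 6 ω) (-x) s :=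
  rfl

/-- **If on `[0, t]` the gap is in the open band and the ratio `x² exp(-∫2/gap²)/|gap|` is in
`(1/N, N)`, and `t < N`, then `t < ρ_n`.** [folklore] -/
theorem coe_lt_locTime_of_forall (hx1 : 1 / level n < |x|) (hx2 : |x| < level n) {ω : ℝ≥0 → ℝ}
    {t : ℝ≥0} (htN : (t : ℝ) < level n)
    (hband : ∀ s ≤ t, gap x s ω ∈ Ioo (bandLo x n) (bandHi x n))
    (hratio : ∀ s ≤ t, x ^ 2 * Real.exp (-∫ r in (0 : ℝ)..s, 2 / gap x r.toNNReal ω ^ 2) /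
      |gap x s ω| ∈ Ioo (1 / level n) (level n)) :
    (t : WithTop ℝ≥0) < locTime x n ω := by
  have hx := ne_zero_of_inv_level_lt hx1
  have h0 : gap x 0 ω ∈ Ioo (bandLo x n) (bandHi x n) := by
    rw [gap_zero hx]; exact neg_mem_Ioo_band hx1 hx2
  -- the band exit is after `t`
  have h1 : (t : WithTop ℝ≥0) < gapExit x n ω := by
    refine Process.coe_lt_exitTime_of_stoppedProcess_mem_Ioo (continuous_gap hx ω) h0 ?_
    have hle : (min (t : WithTop ℝ≥0) (gapExit x n ω)).untopA ≤ t := untopA_min_le t _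
    exact hband _ hle
  -- hence before `t` the pre-localised ratio is the raw ratio
  have hpre : ∀ s ≤ t, ratioPre x n s ω = x ^ 2 *
      Real.exp (-∫ r in (0 : ℝ)..s, 2 / gap x r.toNNReal ω ^ 2) / |gap x s ω| := by
    intro s hs
    have hsE : (s : WithTop ℝ≥0) ≤ gapExit x n ω := (WithTop.coe_le_coe.2 hs).trans h1.le
    have hI : timeIntegral (trunc (gapExit x n)
        fun s ω ↦ 2 / stoppedProcess (gap x) (gapExit x n) s ω ^ 2) s ω =
        ∫ r in (0 : ℝ)..s, 2 / gap x r.toNNReal ω ^ 2 := by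
      unfold timeIntegral
      refine intervalIntegral.integral_congr fun r hr ↦ ?_
      rw [uIcc_of_le s.coe_nonneg] at hr
      have hrE : (r.toNNReal : WithTop ℝ≥0) ≤ gapExit x n ω :=
        (WithTop.coe_le_coe.2 ((Real.toNNReal_le_iff_le_coe.2 hr.2).trans hs)).trans h1.le
      simp only [trunc_of_le hrE, stoppedProcess_eq_of_le hrE]
    unfold ratioPre poleDerivPre
    rw [stoppedProcess_eq_of_le hsE, hI]
  have h2 : (t : WithTop ℝ≥0) < Process.exitTime (ratioPre x n) (1 / level n) (level n) ω := by
    have hr0 : ratioPre x n 0 ω ∈ Ioo (1 / level n) (level n) := by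
      rw [ratioPre_zero hx]; exact ⟨hx1, hx2⟩
    refine Process.coe_lt_exitTime_of_stoppedProcess_mem_Ioo (continuous_ratioPre hx1 hx2 ω) hr0 ?_
    have hle : (min (t : WithTop ℝ≥0) (Process.exitTime (ratioPre x n) (1 / level n) (level n) ω)).untopA
        ≤ t := untopA_min_le t _
    show ratioPre x n _ ω ∈ _
    rw [hpre _ hle]
    exact hratio _ hle
  have h3 : (t : WithTop ℝ≥0) < (((n : ℝ≥0) + 1 : ℝ≥0) : WithTop ℝ≥0) := by
    rw [WithTop.coe_lt_coe, ← NNReal.coe_lt_coe, coe_cap]; exact htN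
  exact lt_min h1 (lt_min h2 h3)

/-- **The localising time is before the swallowing time of the pole.** [folklore] -/
theorem locTime_lt_swallowingTime (hx1 : 1 / level n < |x|) (hx2 : |x| < level n) (ω : ℝ≥0 → ℝ) :
    locTime x n ω < swallowingTime (sleDriving 6 ω) ((-x : ℝ) : ℂ) := by
  obtain ⟨ρ, hρ⟩ := WithTop.ne_top_iff_exists.1 (locTime_ne_top (x := x) (n := n) ω)
  rw [← hρ]
  have h : gap x ρ ω ≠ 0 := gap_ne_zero_of_le hx1 hx2 ω ρ (by rw [hρ])
  exact coe_lt_swallowingTime_of_realFlowStop_ne_zero h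

/-- Before the swallowing time the gap keeps the sign of `-x`: it lies in every open band whose
levels enclose `|gap|`. [folklore] -/
theorem gap_mem_Ioo_band_of_abs {x : ℝ} (hx : x ≠ 0) {n : ℕ} {ω : ℝ≥0 → ℝ} {s : ℝ≥0}
    (hs : (s : WithTop ℝ≥0) < swallowingTime (sleDriving 6 ω) ((-x : ℝ) : ℂ))
    (h1 : 1 / level n < |gap x s ω|) (h2 : |gap x s ω| < level n) :
    gap x s ω ∈ Ioo (bandLo x n) (bandHi x n) := by
  have hW := continuous_sleDriving 6 ω
  unfold bandLo bandHi
  split_ifs with hpos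
  · have hneg : gap x s ω < 0 :=
      realFlowStop_neg_of_lt hW (by rw [sleDriving_zero]; linarith) hs
    rw [abs_of_neg hneg] at h1 h2
    exact ⟨by linarith, by linarith⟩
  · have hxneg : x < 0 := lt_of_le_of_ne (not_lt.1 hpos) hx
    have hpos' : 0 < gap x s ω :=
      realFlowStop_pos_of_lt hW (by rw [sleDriving_zero]; linarith) hs
    rw [abs_of_pos hpos'] at h1 h2
    exact ⟨h1, h2⟩

/-- The exponential factor `exp(-∫₀ˢ 2/gap²)` lies in `[exp(-∫₀ᵗ 2/gap²), 1]` for `s ≤ t` when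
the gap does not vanish on `[0, t]` (nonnegative integrand, continuous there). [folklore] -/
theorem exp_neg_integral_gap_mem {x : ℝ} (hx : x ≠ 0) {ω : ℝ≥0 → ℝ} {t : ℝ≥0}
    (hne : ∀ s ≤ t, gap x s ω ≠ 0) {s : ℝ≥0} (hs : s ≤ t) :
    Real.exp (-∫ r in (0 : ℝ)..s, 2 / gap x r.toNNReal ω ^ 2) ∈
      Icc (Real.exp (-∫ r in (0 : ℝ)..t, 2 / gap x r.toNNReal ω ^ 2)) 1 := by
  have hcont : ContinuousOn (fun r : ℝ ↦ 2 / gap x r.toNNReal ω ^ 2) (Icc 0 t) := by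
    refine continuousOn_const.div ((((continuous_gap hx ω).comp
      continuous_real_toNNReal).pow 2).continuousOn) fun r hr ↦ pow_ne_zero 2 (hne _ ?_)
    exact Real.toNNReal_le_iff_le_coe.2 hr.2
  have hint : IntervalIntegrable (fun r : ℝ ↦ 2 / gap x r.toNNReal ω ^ 2) volume 0 t :=
    (hcont.intervalIntegrable_of_Icc t.coe_nonneg)
  have hnn : ∀ r : ℝ, 0 ≤ 2 / gap x r.toNNReal ω ^ 2 := fun r ↦ by positivity
  constructor
  · apply Real.exp_le_exp.2
    apply neg_le_neg
    exact intervalIntegral.integral_mono_interval le_rfl s.coe_nonneg (NNReal.coe_le_coe.2 hs)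
      (ae_of_all _ fun r ↦ hnn r) hint
  · rw [Real.exp_le_one_iff, neg_nonpos]
    exact intervalIntegral.integral_nonneg s.coe_nonneg fun r _ ↦ hnn r

/-- **The localising times exhaust the swallowing time of the pole**: if `T_{-x} = T < ∞` then
`ρ_n → T`. [cite: Lawler2005, §6.3] -/
theorem tendsto_locTime {x : ℝ} (hx : x ≠ 0) (ω : ℝ≥0 → ℝ) {T : ℝ≥0}
    (hT : swallowingTime (sleDriving 6 ω) ((-x : ℝ) : ℂ) = T) :
    Tendsto (fun n ↦ ((locTime x n ω).untopD 0 : ℝ≥0)) atTop (𝓝 T) := by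
  have hW := continuous_sleDriving 6 ω
  have habs : 0 < |x| := abs_pos.2 hx
  have hlevge : ∀ C : ℝ, ∀ᶠ n : ℕ in atTop, C < level n := fun C ↦ by
    obtain ⟨N₀, hN₀⟩ := exists_nat_gt C
    filter_upwards [eventually_ge_atTop N₀] with n hn
    have hn' : (N₀ : ℝ) ≤ level n := by unfold level; exact_mod_cast Nat.le_succ_of_le hn
    exact hN₀.trans_le hn'
  have hlevinv : ∀ c : ℝ, 0 < c → ∀ᶠ n : ℕ in atTop, 1 / level n < c := fun c hc ↦ by
    filter_upwards [hlevge (1 / c)] with n hn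
    have hN : 0 < level n := by unfold level; positivity
    rw [div_lt_iff₀ hN]; rw [div_lt_iff₀ hc] at hn; linarith
  -- eventually the level hypotheses hold
  have hlev : ∀ᶠ n : ℕ in atTop, 1 / level n < |x| ∧ |x| < level n :=
    (hlevinv _ habs).and (hlevge _)
  -- upper bound: `ρ_n ≤ T` eventually
  have hupper : ∀ᶠ n : ℕ in atTop, ((locTime x n ω).untopD 0 : ℝ≥0) ≤ T := by
    filter_upwards [hlev] with n hn
    have h := locTime_lt_swallowingTime hn.1 hn.2 ω
    rw [hT] at h
    obtain ⟨ρ, hρ⟩ := WithTop.ne_top_iff_exists.1 (locTime_ne_top (x := x) (n := n) ω)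
    rw [← hρ, WithTop.untopD_coe]
    rw [← hρ] at h
    exact (WithTop.coe_lt_coe.1 h).le
  -- lower bound: for `t < T`, eventually `t < ρ_n`
  have hlower : ∀ t : ℝ≥0, t < T → ∀ᶠ n : ℕ in atTop, t < ((locTime x n ω).untopD 0 : ℝ≥0) := by
    intro t htT
    have hts : ∀ s ≤ t, (s : WithTop ℝ≥0) < swallowingTime (sleDriving 6 ω) ((-x : ℝ) : ℂ) :=
        fun s hs ↦ by
      rw [hT]; exact WithTop.coe_lt_coe.2 (hs.trans_lt htT)
    have hne : ∀ s ≤ t, gap x s ω ≠ 0 := fun s hs ↦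
      realFlowStop_ne_zero_of_lt hW (by rw [sleDriving_zero]; exact neg_ne_zero.2 hx) (hts s hs)
    obtain ⟨m, M, hm, hmM⟩ := exists_pos_bounds_of_continuous
      (continuous_abs.comp (continuous_gap hx ω)) t (fun s hs ↦ abs_pos.2 (hne s hs))
    set δ : ℝ := Real.exp (-∫ r in (0 : ℝ)..t, 2 / gap x r.toNNReal ω ^ 2) with hδ
    have hδpos : 0 < δ := Real.exp_pos _
    have hMpos : 0 < M := hm.trans_le ((hmM 0 bot_le).1.trans (hmM 0 bot_le).2)
    filter_upwards [hlev, hlevge t, hlevge M, hlevge (x ^ 2 / m), hlevinv m hm,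
      hlevinv (x ^ 2 * δ / M) (by positivity)] with n hn hnt hnM hnr hninv hninv'
    have hlt : (t : WithTop ℝ≥0) < locTime x n ω := by
      refine coe_lt_locTime_of_forall hn.1 hn.2 hnt (fun s hs ↦ ?_) (fun s hs ↦ ?_)
      · obtain ⟨h1, h2⟩ := hmM s hs
        exact gap_mem_Ioo_band_of_abs hx (hts s hs) (by simp only [comp_apply] at h1; linarith)
          (by simp only [comp_apply] at h2; linarith)
      · obtain ⟨h1, h2⟩ := hmM s hs
        simp only [comp_apply] at h1 h2
        have hgpos : 0 < |gap x s ω| := hm.trans_le h1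
        obtain ⟨he1, he2⟩ := exp_neg_integral_gap_mem hx hne hs
        constructor
        · rw [lt_div_iff₀ hgpos]
          calc 1 / level n * |gap x s ω| ≤ 1 / level n * M := by
                apply mul_le_mul_of_nonneg_left h2; have := (show 0 < level n by unfold level; positivity); positivity
            _ < x ^ 2 * δ / M * M := by
                apply mul_lt_mul_of_pos_right hninv' hMpos
            _ = x ^ 2 * δ := by field_simp
            _ ≤ x ^ 2 * Real.exp (-∫ r in (0 : ℝ)..s, 2 / gap x r.toNNReal ω ^ 2) := by
                apply mul_le_mul_of_nonneg_left he1 (sq_nonneg x)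
        · rw [div_lt_iff₀ hgpos]
          calc x ^ 2 * Real.exp (-∫ r in (0 : ℝ)..s, 2 / gap x r.toNNReal ω ^ 2) ≤ x ^ 2 * 1 :=
                mul_le_mul_of_nonneg_left he2 (sq_nonneg x)
            _ = x ^ 2 / m * m := by field_simp
            _ < level n * m := mul_lt_mul_of_pos_right hnr hm
            _ ≤ level n * |gap x s ω| := by
                apply mul_le_mul_of_nonneg_left h1; have := (show 0 < level n by unfold level; positivity); positivity
    obtain ⟨ρ, hρ⟩ := WithTop.ne_top_iff_exists.1 (locTime_ne_top (x := x) (n := n) ω)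
    rw [← hρ, WithTop.untopD_coe]
    rw [← hρ] at hlt
    exact WithTop.coe_lt_coe.1 hlt
  -- conclude
  rw [tendsto_order]
  refine ⟨fun t ht ↦ hlower t ht, fun t ht ↦ ?_⟩
  filter_upwards [hupper] with n hn using hn.trans_lt ht

end Original

/-! ### The point side: `pointLocTime y (y²) n U → T_y` -/

section Point

variable {y : ℝ} {n : ℕ}

/-- The band of level `N` lies inside the wide band of level `2N`. [folklore] -/
theorem Ioo_band_subset_wide (y : ℝ) (n : ℕ) :
    Ioo (bandLo (-y) n) (bandHi (-y) n) ⊆ Ioo (bandLo (-y) (2 * n + 1)) (bandHi (-y) (2 * n + 1)) := by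
  have hN : 0 < level n := by unfold level; positivity
  have hlev : level (2 * n + 1) = 2 * level n := by unfold level; push_cast; ring
  have h1 : 1 / (2 * level n) ≤ 1 / level n := one_div_le_one_div_of_le hN (by linarith)
  unfold bandLo bandHi
  rw [hlev]
  split_ifs
  · exact Ioo_subset_Ioo (by linarith) (by linarith)
  · exact Ioo_subset_Ioo h1 (by linarith)

/-- **If on `[0, t]` the gap of `y` is in the open band, the ratio `y² exp(-∫2/gap²)/|gap|` in
`(1/N, N)` and the original-time functional below `N`, then `t < pointLocTime y y² n U`.**
[folklore] -/
theorem coe_lt_pointLocTime_of_forall (hy1 : 1 / level n < |y|) (hy2 : |y| < level n)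
    {U : ℝ≥0 → ℝ} {t : ℝ≥0}
    (hband : ∀ s ≤ t, pointGap y s U ∈ Ioo (bandLo (-y) n) (bandHi (-y) n))
    (hratio : ∀ s ≤ t, y ^ 2 * Real.exp (-∫ r in (0 : ℝ)..s, 2 / pointGap y r.toNNReal U ^ 2) /
      |pointGap y s U| ∈ Ioo (1 / level n) (level n))
    (htime : ∀ s ≤ t, ∫ r in (0 : ℝ)..s, (y ^ 2 *
      Real.exp (-∫ r' in (0 : ℝ)..r, 2 / pointGap y r'.toNNReal U ^ 2) /
        pointGap y r.toNNReal U ^ 2) ^ 2 < level n) :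
    (t : WithTop ℝ≥0) < pointLocTime y (y ^ 2) n U := by
  have hy := ne_zero_of_inv_level_lt hy1
  have hN : 0 < level n := by unfold level; positivity
  have h0 : pointGap y 0 U ∈ Ioo (bandLo (-y) n) (bandHi (-y) n) := by
    rw [pointGap_zero hy]
    have h := neg_mem_Ioo_band (x := -y) (n := n) (by rwa [abs_neg]) (by rwa [abs_neg])
    rwa [neg_neg] at h
  have h0w : pointGap y 0 U ∈ Ioo (bandLo (-y) (2 * n + 1)) (bandHi (-y) (2 * n + 1)) :=
    Ioo_band_subset_wide y n h0
  -- the wide exit is after `t`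
  have h1 : (t : WithTop ℝ≥0) < pointWideExit y n U := by
    refine Process.coe_lt_exitTime_of_stoppedProcess_mem_Ioo (continuous_pointGap hy U) h0w ?_
    have hle : (min (t : WithTop ℝ≥0) (pointWideExit y n U)).untopA ≤ t := untopA_min_le t _
    exact Ioo_band_subset_wide y n (hband _ hle)
  -- hence before `t` the stopped / killed processes are the raw ones
  have hstop : ∀ s ≤ t, pointGapStop y n s U = pointGap y s U := fun s hs ↦
    stoppedProcess_eq_of_le ((WithTop.coe_le_coe.2 hs).trans h1.le)
  have hderiv : ∀ s ≤ t, pointDeriv y n s U =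
      Real.exp (-∫ r in (0 : ℝ)..s, 2 / pointGap y r.toNNReal U ^ 2) := by
    intro s hs
    unfold pointDeriv timeIntegral
    congr 2
    refine intervalIntegral.integral_congr fun r hr ↦ ?_
    rw [uIcc_of_le s.coe_nonneg] at hr
    have hr' : r.toNNReal ≤ t := (Real.toNNReal_le_iff_le_coe.2 hr.2).trans hs
    have hrE : (r.toNNReal : WithTop ℝ≥0) ≤ pointWideExit y n U := (WithTop.coe_le_coe.2 hr').trans h1.le
    simp only [trunc_of_le hrE, hstop _ hr']
  have htime' : ∀ s ≤ t, pointTime y (y ^ 2) n s U = ∫ r in (0 : ℝ)..s, (y ^ 2 *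
      Real.exp (-∫ r' in (0 : ℝ)..r, 2 / pointGap y r'.toNNReal U ^ 2) /
        pointGap y r.toNNReal U ^ 2) ^ 2 := by
    intro s hs
    unfold pointTime timeIntegral
    refine intervalIntegral.integral_congr fun r hr ↦ ?_
    rw [uIcc_of_le s.coe_nonneg] at hr
    have hr' : r.toNNReal ≤ t := (Real.toNNReal_le_iff_le_coe.2 hr.2).trans hs
    have hrE : (r.toNNReal : WithTop ℝ≥0) ≤ pointWideExit y n U := (WithTop.coe_le_coe.2 hr').trans h1.le
    simp only [trunc_of_le hrE, hstop _ hr', hderiv _ hr']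
    rw [Real.coe_toNNReal _ hr.1]
  have hratio' : ∀ s ≤ t, pointRatio y (y ^ 2) n s U = y ^ 2 *
      Real.exp (-∫ r in (0 : ℝ)..s, 2 / pointGap y r.toNNReal U ^ 2) / |pointGap y s U| := by
    intro s hs
    unfold pointRatio
    rw [hderiv s hs, hstop s hs]
  -- the three exits are after `t`
  have h2 : (t : WithTop ℝ≥0) <
      Process.exitTime (pointGapStop y n) (bandLo (-y) n) (bandHi (-y) n) U := by
    have h0' : pointGapStop y n 0 U ∈ Ioo (bandLo (-y) n) (bandHi (-y) n) := by
      rw [hstop 0 bot_le]; exact h0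
    refine Process.coe_lt_exitTime_of_stoppedProcess_mem_Ioo (continuous_pointGapStop hy U) h0' ?_
    have hle : (min (t : WithTop ℝ≥0)
        (Process.exitTime (pointGapStop y n) (bandLo (-y) n) (bandHi (-y) n) U)).untopA ≤ t :=
      untopA_min_le t _
    show pointGapStop y n _ U ∈ _
    rw [hstop _ hle]
    exact hband _ hle
  have h3 : (t : WithTop ℝ≥0) <
      Process.exitTime (pointRatio y (y ^ 2) n) (1 / level n) (level n) U := by
    have h0' : pointRatio y (y ^ 2) n 0 U ∈ Ioo (1 / level n) (level n) := by
      rw [hratio' 0 bot_le, pointGap_zero hy]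
      simp only [NNReal.coe_zero, intervalIntegral.integral_same, neg_zero, Real.exp_zero, mul_one]
      have : y ^ 2 / |y| = |y| := by
        rw [← sq_abs, sq, mul_div_assoc, div_self (abs_pos.2 hy).ne', mul_one]
      rw [this]; exact ⟨hy1, hy2⟩
    refine Process.coe_lt_exitTime_of_stoppedProcess_mem_Ioo (continuous_pointRatio hy1 hy2 U) h0' ?_
    have hle : (min (t : WithTop ℝ≥0)
        (Process.exitTime (pointRatio y (y ^ 2) n) (1 / level n) (level n) U)).untopA ≤ t :=
      untopA_min_le t _
    show pointRatio y (y ^ 2) n _ U ∈ _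
    rw [hratio' _ hle]
    exact hratio _ hle
  have h4 : (t : WithTop ℝ≥0) < Process.exitTime (pointTime y (y ^ 2) n) (-1) (level n) U := by
    have h0' : pointTime y (y ^ 2) n 0 U ∈ Ioo (-1 : ℝ) (level n) := by
      unfold pointTime; rw [timeIntegral_apply_zero]; exact ⟨by norm_num, hN⟩
    refine Process.coe_lt_exitTime_of_stoppedProcess_mem_Ioo (continuous_pointTime hy1 hy2 U) h0' ?_
    have hle : (min (t : WithTop ℝ≥0)
        (Process.exitTime (pointTime y (y ^ 2) n) (-1) (level n) U)).untopA ≤ t :=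
      untopA_min_le t _
    show pointTime y (y ^ 2) n _ U ∈ _
    rw [htime' _ hle]
    refine ⟨?_, htime _ hle⟩
    have hnn : 0 ≤ ∫ r in (0 : ℝ)..((min (t : WithTop ℝ≥0)
        (Process.exitTime (pointTime y (y ^ 2) n) (-1) (level n) U)).untopA : ℝ≥0), (y ^ 2 *
        Real.exp (-∫ r' in (0 : ℝ)..r, 2 / pointGap y r'.toNNReal U ^ 2) /
          pointGap y r.toNNReal U ^ 2) ^ 2 :=
      intervalIntegral.integral_nonneg (NNReal.coe_nonneg _) fun r _ ↦ sq_nonneg _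
    linarith
  exact lt_min h1 (lt_min h2 (lt_min h3 h4))

/-- **The intrinsic localising time is before the swallowing time of the tracked point** (finite
case): the gap comes below the inner wide level before `T_y` (`IsSolution.exists_norm_sub_lt`),
so the wide exit, hence `pointLocTime`, is `< T_y`. [folklore] -/
theorem pointLocTime_lt_of_swallowingTime_eq (hy1 : 1 / level n < |y|)
    {b : ℝ} (U : ℝ≥0 → ℝ) {T : ℝ≥0} (hT : swallowingTime (regPath U) y = T) :
    pointLocTime y b n U < T := by
  have hy := ne_zero_of_inv_level_lt hy1
  have hN : 0 < level n := by unfold level; positivity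
  have hW := continuous_regPath U
  have hy0 : (y : ℂ) ≠ regPath U 0 := by
    rw [regPath_zero]; exact_mod_cast hy
  have hTpos : 0 < T := by
    have h := swallowingTime_pos_holds hW hy0
    rwa [hT, WithTop.coe_pos] at h
  obtain ⟨g, hg⟩ := exists_isSolution_swallowingTime_holds hW hy0
  rw [hT] at hg
  have hlev : level (2 * n + 1) = 2 * level n := by unfold level; push_cast; ring
  obtain ⟨t', ht'0, ht'T, hlt⟩ := hg.exists_norm_sub_lt hW hTpos hT (δ := 1 / (2 * level n))
    (by positivity)
  set s : ℝ≥0 := t'.toNNReal with hs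
  have hsT : s < T := by rw [hs]; exact (Real.toNNReal_lt_iff_lt_coe ht'0).2 ht'T
  have hscoe : (s : ℝ) = t' := Real.coe_toNNReal _ ht'0
  have hsT' : (s : WithTop ℝ≥0) < swallowingTime (regPath U) y := by
    rw [hT]; exact WithTop.coe_lt_coe.2 hsT
  -- the gap at `s` is small
  have hgap : |pointGap y s U| < 1 / (2 * level n) := by
    have h1 : pointGap y s U = (g s).re - regPath U s := by
      unfold pointGap
      rw [realFlowStop_of_lt hsT', realFlow_eq_re_sub hW hg (by exact WithTop.coe_lt_coe.2 hsT)]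
    have h2 : (g s).re - regPath U s = (g t' - regPath U t'.toNNReal).re := by
      rw [Complex.sub_re, Complex.ofReal_re, hscoe]
    rw [h1, h2]
    exact (Complex.abs_re_le_norm _).trans_lt hlt
  -- so the wide exit is `≤ s`
  have hout : pointGap y s U ∉ Ioo (bandLo (-y) (2 * n + 1)) (bandHi (-y) (2 * n + 1)) := by
    unfold bandLo bandHi
    rw [hlev]
    rw [abs_lt] at hgap
    split_ifs with h
    · exact fun hm ↦ by linarith [hm.2, hgap.1]
    · exact fun hm ↦ by linarith [hm.1, hgap.2]
  have hle : pointWideExit y n U ≤ s :=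
    (Process.exitTime_le_coe_iff (continuous_pointGap hy U)).2 ⟨s, le_rfl, hout⟩
  exact ((min_le_left _ _).trans hle).trans_lt (WithTop.coe_lt_coe.2 hsT)

/-- Before the swallowing time the gap of `y` keeps the sign of `y`. [folklore] -/
theorem pointGap_mem_Ioo_band_of_abs (hy : y ≠ 0) {U : ℝ≥0 → ℝ} {s : ℝ≥0}
    (hs : (s : WithTop ℝ≥0) < swallowingTime (regPath U) y)
    (h1 : 1 / level n < |pointGap y s U|) (h2 : |pointGap y s U| < level n) :
    pointGap y s U ∈ Ioo (bandLo (-y) n) (bandHi (-y) n) := by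
  have hW := continuous_regPath U
  unfold bandLo bandHi
  split_ifs with hneg
  · have hyn : y < 0 := by linarith
    have hlt : pointGap y s U < 0 := realFlowStop_neg_of_lt hW (by rw [regPath_zero]; exact hyn) hs
    rw [abs_of_neg hlt] at h1 h2
    exact ⟨by linarith, by linarith⟩
  · have hyp : 0 < y := lt_of_le_of_ne (by linarith) (Ne.symm hy)
    have hgt : 0 < pointGap y s U := realFlowStop_pos_of_lt hW (by rw [regPath_zero]; exact hyp) hs
    rw [abs_of_pos hgt] at h1 h2
    exact ⟨h1, h2⟩

/-- **The intrinsic localising times exhaust the swallowing time of the tracked point**: if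
`T_y = T < ∞` then `pointLocTime y y² n U → T`. [cite: Lawler2005, §6.3] -/
theorem tendsto_pointLocTime {y : ℝ} (hy : y ≠ 0) (U : ℝ≥0 → ℝ) {T : ℝ≥0}
    (hT : swallowingTime (regPath U) y = T) :
    Tendsto (fun n ↦ ((pointLocTime y (y ^ 2) n U).untopD 0 : ℝ≥0)) atTop (𝓝 T) := by
  have hW := continuous_regPath U
  have habs : 0 < |y| := abs_pos.2 hy
  have hlevge : ∀ C : ℝ, ∀ᶠ n : ℕ in atTop, C < level n := fun C ↦ by
    obtain ⟨N₀, hN₀⟩ := exists_nat_gt C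
    filter_upwards [eventually_ge_atTop N₀] with n hn
    have hn' : (N₀ : ℝ) ≤ level n := by unfold level; exact_mod_cast Nat.le_succ_of_le hn
    exact hN₀.trans_le hn'
  have hlevinv : ∀ c : ℝ, 0 < c → ∀ᶠ n : ℕ in atTop, 1 / level n < c := fun c hc ↦ by
    filter_upwards [hlevge (1 / c)] with n hn
    have hN : 0 < level n := by unfold level; positivity
    rw [div_lt_iff₀ hN]; rw [div_lt_iff₀ hc] at hn; linarith
  have hlev : ∀ᶠ n : ℕ in atTop, 1 / level n < |y| ∧ |y| < level n :=
    (hlevinv _ habs).and (hlevge _)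
  -- upper bound
  have hupper : ∀ᶠ n : ℕ in atTop, ((pointLocTime y (y ^ 2) n U).untopD 0 : ℝ≥0) ≤ T := by
    filter_upwards [hlev] with n hn
    have h := pointLocTime_lt_of_swallowingTime_eq hn.1 (b := y ^ 2) U hT
    have hne : pointLocTime y (y ^ 2) n U ≠ ⊤ := ne_top_of_lt h
    obtain ⟨ρ, hρ⟩ := WithTop.ne_top_iff_exists.1 hne
    rw [← hρ, WithTop.untopD_coe]
    rw [← hρ] at h
    exact (WithTop.coe_lt_coe.1 h).le
  -- lower bound
  have hlower : ∀ t : ℝ≥0, t < T → ∀ᶠ n : ℕ in atTop,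
      t < ((pointLocTime y (y ^ 2) n U).untopD 0 : ℝ≥0) := by
    intro t htT
    have hts : ∀ s ≤ t, (s : WithTop ℝ≥0) < swallowingTime (regPath U) y := fun s hs ↦ by
      rw [hT]; exact WithTop.coe_lt_coe.2 (hs.trans_lt htT)
    have hne : ∀ s ≤ t, pointGap y s U ≠ 0 := fun s hs ↦
      realFlowStop_ne_zero_of_lt hW (by rw [regPath_zero]; exact hy) (hts s hs)
    obtain ⟨m, M, hm, hmM⟩ := exists_pos_bounds_of_continuous
      (continuous_abs.comp (continuous_pointGap hy U)) t (fun s hs ↦ abs_pos.2 (hne s hs))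
    -- the exponential factor on `[0, t]`
    set e : ℝ≥0 → ℝ := fun s ↦ Real.exp (-∫ r in (0 : ℝ)..s, 2 / pointGap y r.toNNReal U ^ 2)
      with he
    have hemem : ∀ s ≤ t, e s ∈ Icc (e t) 1 := by
      intro s hs
      have hcont : ContinuousOn (fun r : ℝ ↦ 2 / pointGap y r.toNNReal U ^ 2) (Icc 0 t) := by
        refine continuousOn_const.div ((((continuous_pointGap hy U).comp
          continuous_real_toNNReal).pow 2).continuousOn) fun r hr ↦ pow_ne_zero 2 (hne _ ?_)
        exact Real.toNNReal_le_iff_le_coe.2 hr.2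
      have hint : IntervalIntegrable (fun r : ℝ ↦ 2 / pointGap y r.toNNReal U ^ 2) volume 0 t :=
        hcont.intervalIntegrable_of_Icc t.coe_nonneg
      have hnn : ∀ r : ℝ, 0 ≤ 2 / pointGap y r.toNNReal U ^ 2 := fun r ↦ by positivity
      constructor
      · apply Real.exp_le_exp.2
        apply neg_le_neg
        exact intervalIntegral.integral_mono_interval le_rfl s.coe_nonneg (NNReal.coe_le_coe.2 hs)
          (ae_of_all _ fun r ↦ hnn r) hint
      · rw [he]; dsimp only
        rw [Real.exp_le_one_iff, neg_nonpos]
        exact intervalIntegral.integral_nonneg s.coe_nonneg fun r _ ↦ hnn r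
    set δ : ℝ := e t with hδ
    have hδpos : 0 < δ := Real.exp_pos _
    have hMpos : 0 < M := hm.trans_le ((hmM 0 bot_le).1.trans (hmM 0 bot_le).2)
    -- bound for the original-time integrand
    set C : ℝ := (y ^ 2 / m ^ 2) ^ 2 * t with hC
    have hFbd : ∀ r : ℝ, r ∈ Set.uIoc (0 : ℝ) t → ‖(y ^ 2 * e r.toNNReal / pointGap y r.toNNReal U ^ 2) ^ 2‖
        ≤ (y ^ 2 / m ^ 2) ^ 2 := by
      intro r hr
      rw [uIoc_of_le t.coe_nonneg] at hr
      have hr' : r.toNNReal ≤ t := Real.toNNReal_le_iff_le_coe.2 hr.2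
      rw [Real.norm_eq_abs, abs_pow, abs_div, abs_mul, abs_of_nonneg (sq_nonneg y),
        abs_of_pos (Real.exp_pos _), abs_pow]
      have hg1 := (hmM _ hr').1
      simp only [comp_apply] at hg1
      have hgpos : 0 < |pointGap y r.toNNReal U| := hm.trans_le hg1
      apply pow_le_pow_left₀ (by positivity)
      rw [div_le_div_iff₀ (by positivity) (by positivity)]
      have he1 := (hemem _ hr').2
      have hm2 : m ^ 2 ≤ |pointGap y r.toNNReal U| ^ 2 := pow_le_pow_left₀ hm.le hg1 2
      calc y ^ 2 * e r.toNNReal * m ^ 2 ≤ y ^ 2 * 1 * m ^ 2 := by gcongr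
        _ ≤ y ^ 2 * |pointGap y r.toNNReal U| ^ 2 := by rw [mul_one]; gcongr
    filter_upwards [hlev, hlevge t, hlevge M, hlevge (y ^ 2 / m), hlevinv m hm,
      hlevinv (y ^ 2 * δ / M) (by positivity), hlevge C] with n hn hnt hnM hnr hninv hninv' hnC
    have hNpos : 0 < level n := by unfold level; positivity
    have hlt : (t : WithTop ℝ≥0) < pointLocTime y (y ^ 2) n U := by
      refine coe_lt_pointLocTime_of_forall hn.1 hn.2 (fun s hs ↦ ?_) (fun s hs ↦ ?_) (fun s hs ↦ ?_)
      · obtain ⟨h1, h2⟩ := hmM s hs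
        simp only [comp_apply] at h1 h2
        exact pointGap_mem_Ioo_band_of_abs hy (hts s hs) (by linarith) (by linarith)
      · obtain ⟨h1, h2⟩ := hmM s hs
        simp only [comp_apply] at h1 h2
        have hgpos : 0 < |pointGap y s U| := hm.trans_le h1
        obtain ⟨he1, he2⟩ := hemem s hs
        constructor
        · rw [lt_div_iff₀ hgpos]
          calc 1 / level n * |pointGap y s U| ≤ 1 / level n * M := by
                apply mul_le_mul_of_nonneg_left h2; positivity
            _ < y ^ 2 * δ / M * M := mul_lt_mul_of_pos_right hninv' hMpos
            _ = y ^ 2 * δ := by field_simp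
            _ ≤ y ^ 2 * e s := mul_le_mul_of_nonneg_left he1 (sq_nonneg y)
        · rw [div_lt_iff₀ hgpos]
          calc y ^ 2 * e s ≤ y ^ 2 * 1 := mul_le_mul_of_nonneg_left he2 (sq_nonneg y)
            _ = y ^ 2 / m * m := by field_simp
            _ < level n * m := mul_lt_mul_of_pos_right hnr hm
            _ ≤ level n * |pointGap y s U| := by
                apply mul_le_mul_of_nonneg_left h1; positivity
      · have hb := intervalIntegral.norm_integral_le_of_norm_le_const (a := (0 : ℝ)) (b := (s : ℝ))
          (C := (y ^ 2 / m ^ 2) ^ 2)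
          (f := fun r ↦ (y ^ 2 * e r.toNNReal / pointGap y r.toNNReal U ^ 2) ^ 2) (fun r hr ↦ by
            refine hFbd r ?_
            rw [uIoc_of_le s.coe_nonneg] at hr
            rw [uIoc_of_le t.coe_nonneg]
            exact ⟨hr.1, hr.2.trans (NNReal.coe_le_coe.2 hs)⟩)
        rw [Real.norm_eq_abs, sub_zero, abs_of_nonneg s.coe_nonneg] at hb
        have hst : (s : ℝ) ≤ t := NNReal.coe_le_coe.2 hs
        have heqI : ∫ r in (0 : ℝ)..s, (y ^ 2 *
            Real.exp (-∫ r' in (0 : ℝ)..r, 2 / pointGap y r'.toNNReal U ^ 2) /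
              pointGap y r.toNNReal U ^ 2) ^ 2 =
            ∫ r in (0 : ℝ)..s, (y ^ 2 * e r.toNNReal / pointGap y r.toNNReal U ^ 2) ^ 2 := by
          refine intervalIntegral.integral_congr fun r hr ↦ ?_
          rw [uIcc_of_le s.coe_nonneg] at hr
          simp only [he, Real.coe_toNNReal _ hr.1]
        rw [heqI]
        calc ∫ r in (0 : ℝ)..s, (y ^ 2 * e r.toNNReal / pointGap y r.toNNReal U ^ 2) ^ 2
            ≤ (y ^ 2 / m ^ 2) ^ 2 * s := (le_abs_self _).trans hb
          _ ≤ (y ^ 2 / m ^ 2) ^ 2 * t := by gcongr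
          _ < level n := hnC
    have hne' : pointLocTime y (y ^ 2) n U ≠ ⊤ :=
      ne_top_of_lt (pointLocTime_lt_of_swallowingTime_eq hn.1 (b := y ^ 2) U hT)
    obtain ⟨ρ, hρ⟩ := WithTop.ne_top_iff_exists.1 hne'
    rw [← hρ, WithTop.untopD_coe]
    rw [← hρ] at hlt
    exact WithTop.coe_lt_coe.1 hlt
  rw [tendsto_order]
  refine ⟨fun t ht ↦ hlower t ht, fun t ht ↦ ?_⟩
  filter_upwards [hupper] with n hn using hn.trans_lt ht

end Point

end SLESixMoebius

end Literature.Probability.RandomPlanarGeometry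

end


/-!
# The intrinsic localising time of the image chain equals the clock of the localising time

Topic `Probability/RandomPlanarGeometry`; theorems only. The combinatorial heart of the
intrinsic localisation (G. F. Lawler (2005), §6.3, Thm. 6.13 / Prop. 6.14 for the Möbius map
`Φ_x`): under the dictionary between the pole data of the chain of `W = √6 B(ω)` and the real
flow of the tracked point `x` under the image driving function `Û` in capacity time —

  `X̂_s = -(x² d₁/X)(υ s)`, `exp(-∫₀ˢ 2/X̂²) = d₁(υ s)`, `∫₀ˢ (x² d̂/X̂²)² = υ s`

for `s ≤ Ŝ`, `υ` the inverse clock with `υ Ŝ = ρ_n` and `υ s < ρ_n` for `s < Ŝ` — the intrinsic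
localising time of `x` under `Û` is exactly `Ŝ` (`pointLocTime_eq_of_dictionary`): before `Ŝ`
the image box conditions are the original ones read through the dictionary
(`|X̂| = x² d₁/|X| = ratio`, `x² d̂/|X̂| = |X|`, original time `< N`), and at `Ŝ` the
original chain has just left its box. Auxiliary: `ratioPre_eq_of_le`, `abs_mem_Ioo_of_mem_Ioo_band`,
`neg_div_mem_Ioo_band`.

## References

* G. F. Lawler, *Conformally Invariant Processes in the Plane*, AMS (2005), §6.3. [Lawler2005]
-/

noncomputable section

open MeasureTheory Filter Set Function
open scoped NNReal ENNReal Topology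

namespace Literature.Probability.RandomPlanarGeometry

namespace SLESixMoebius

open Loewner Literature.Probability.Process Literature.Analysis.FunctionSpaces

variable {x : ℝ} {n : ℕ}

/-! ### Band bookkeeping -/

/-- The open band lies inside `{y | 1/N < |y| < N}`. [folklore] -/
theorem abs_mem_Ioo_of_mem_Ioo_band {y : ℝ} (hy : y ∈ Ioo (bandLo x n) (bandHi x n)) :
    |y| ∈ Ioo (1 / level n) (level n) := by
  unfold bandLo bandHi at hy
  have hN : 0 < level n := by unfold level; positivity
  have hN' : 0 < 1 / level n := by positivity
  split_ifs at hy with h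
  · have hyneg : y < 0 := by linarith [hy.2]
    rw [abs_of_neg hyneg]
    exact ⟨by linarith [hy.2], by linarith [hy.1]⟩
  · have hypos : 0 < y := by linarith [hy.1]
    rw [abs_of_pos hypos]
    exact hy

/-- A point of the closed band outside the open band is an endpoint, so its absolute value is
`1/N` or `N`. [folklore] -/
theorem abs_notMem_Ioo_of_notMem_Ioo_band {y : ℝ} (hy : y ∈ Icc (bandLo x n) (bandHi x n))
    (hy' : y ∉ Ioo (bandLo x n) (bandHi x n)) : |y| ∉ Ioo (1 / level n) (level n) := by
  have hcases : y = bandLo x n ∨ y = bandHi x n := by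
    rcases hy.1.eq_or_lt with h | h
    · exact Or.inl h.symm
    rcases hy.2.eq_or_lt with h' | h'
    · exact Or.inr h'
    exact absurd ⟨h, h'⟩ hy'
  have hN : 0 < level n := by unfold level; positivity
  have hN' : 0 < 1 / level n := by positivity
  unfold bandLo bandHi at hcases
  intro hmem
  split_ifs at hcases with h
  · rcases hcases with rfl | rfl
    · rw [abs_neg, abs_of_pos hN] at hmem; exact lt_irrefl _ hmem.2
    · rw [abs_neg, abs_of_pos hN'] at hmem; exact lt_irrefl _ hmem.1
  · rcases hcases with rfl | rfl
    · rw [abs_of_pos hN'] at hmem; exact lt_irrefl _ hmem.1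
    · rw [abs_of_pos hN] at hmem; exact lt_irrefl _ hmem.2

/-- **The dictionary value of the image gap lies in the image band**: if `X` is in the closed band
of the pole `-x` (`x ≠ 0`) and `1/N < c/|X| < N`, then `-(c/X)` lies in the open band of the point
`x` (it has the sign of `x`). [folklore] -/
theorem neg_div_mem_Ioo_band (hx0 : x ≠ 0) {X c : ℝ} (hX : X ∈ Icc (bandLo x n) (bandHi x n))
    (h : c / |X| ∈ Ioo (1 / level n) (level n)) :
    -(c / X) ∈ Ioo (bandLo (-x) n) (bandHi (-x) n) := by
  have hN : 0 < level n := by unfold level; positivity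
  have hN' : 0 < 1 / level n := by positivity
  unfold bandLo bandHi at hX ⊢
  by_cases hx : 0 < x
  · simp only [if_pos hx] at hX
    rw [if_neg (by linarith), if_neg (by linarith)]
    have hXneg : X < 0 := by linarith [hX.2]
    rw [abs_of_neg hXneg] at h
    have he : -(c / X) = c / (-X) := by rw [div_neg]
    rw [he]; exact h
  · simp only [if_neg hx] at hX
    have hXpos : 0 < X := by linarith [hX.1]
    rw [abs_of_pos hXpos] at h
    have hxneg : x < 0 := lt_of_le_of_ne (not_lt.1 hx) hx0
    rw [if_pos (by linarith), if_pos (by linarith)]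
    constructor
    · have := h.2; linarith
    · have := h.1; linarith

/-! ### The pre-localised ratio before `ρ` -/

/-- Before `ρ` the pre-localised ratio is `x² D/|X|`. [folklore] -/
theorem ratioPre_eq_of_le {ω : ℝ≥0 → ℝ} {u : ℝ≥0} (hu : (u : WithTop ℝ≥0) ≤ locTime x n ω) :
    ratioPre x n u ω = x ^ 2 * D x n u ω / |X x n u ω| := by
  have huE : (u : WithTop ℝ≥0) ≤ gapExit x n ω := hu.trans (locTime_le_gapExit ω)
  have hI : timeIntegral (trunc (gapExit x n)
      fun s ω ↦ 2 / stoppedProcess (gap x) (gapExit x n) s ω ^ 2) u ω =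
      timeIntegral (dRate x n) u ω := by
    unfold timeIntegral dRate
    refine intervalIntegral.integral_congr fun r hr ↦ ?_
    rw [uIcc_of_le u.coe_nonneg] at hr
    have hr' : r.toNNReal ≤ u := Real.toNNReal_le_iff_le_coe.2 hr.2
    have hrρ : (r.toNNReal : WithTop ℝ≥0) ≤ locTime x n ω := (WithTop.coe_le_coe.2 hr').trans hu
    have hrE : (r.toNNReal : WithTop ℝ≥0) ≤ gapExit x n ω := hrρ.trans (locTime_le_gapExit ω)
    simp only [trunc_of_le hrE, trunc_of_le hrρ, stoppedProcess_eq_of_le hrE, X_eq_gap_of_le hrρ]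
  unfold ratioPre poleDerivPre D
  rw [hI, stoppedProcess_eq_of_le huE, X_eq_gap_of_le hu]

/-- Before `ρ` (strictly) the gap is in the open band and the ratio in `(1/N, N)`; and `u < N`.
[folklore] -/
theorem facts_of_coe_lt_locTime {ω : ℝ≥0 → ℝ} {u : ℝ≥0} (hu : (u : WithTop ℝ≥0) < locTime x n ω) :
    X x n u ω ∈ Ioo (bandLo x n) (bandHi x n) ∧
      x ^ 2 * D x n u ω / |X x n u ω| ∈ Ioo (1 / level n) (level n) ∧ (u : ℝ) < level n := by
  have h1 : (u : WithTop ℝ≥0) < gapExit x n ω := hu.trans_le (locTime_le_gapExit ω)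
  have h2 : (u : WithTop ℝ≥0) < Process.exitTime (ratioPre x n) (1 / level n) (level n) ω :=
    hu.trans_le (locTime_le_ratioExit ω)
  have h3 : (u : WithTop ℝ≥0) < (((n : ℝ≥0) + 1 : ℝ≥0) : WithTop ℝ≥0) := hu.trans_le (locTime_le_cap ω)
  refine ⟨?_, ?_, ?_⟩
  · rw [X_eq_gap_of_le hu.le]; exact Process.mem_Ioo_of_coe_lt_exitTime h1
  · rw [← ratioPre_eq_of_le hu.le]; exact Process.mem_Ioo_of_coe_lt_exitTime h2
  · rw [← coe_cap n]; exact_mod_cast WithTop.coe_lt_coe.1 h3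

/-! ### The matching theorem -/

/-- `↑Ŝ ≤ τ` in `WithTop ℝ≥0` as soon as `↑s < τ` for every `s < Ŝ`. [folklore] -/
theorem coe_le_of_forall_lt {Ŝ : ℝ≥0} {τ : WithTop ℝ≥0} (h : ∀ s : ℝ≥0, s < Ŝ → (s : WithTop ℝ≥0) < τ) :
    (Ŝ : WithTop ℝ≥0) ≤ τ := by
  by_contra hlt
  rw [not_le] at hlt
  obtain ⟨s₀, hs₀⟩ := WithTop.ne_top_iff_exists.1 hlt.ne_top
  rw [← hs₀] at hlt
  have := h s₀ (WithTop.coe_lt_coe.1 hlt)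
  rw [hs₀] at this
  exact lt_irrefl _ this

/-- **The intrinsic localising time of the image equals the clock of the localising time.** Let
`1/N < |x| < N`, `ρ = locTime x n ω = ρf`, and let `Û` be a driving path, `Ŝ` a time and `υ` a map
of times with `υ Ŝ = ρf`, `υ s < ρf` for `s < Ŝ`, such that on `[0, Ŝ]` the gap of `x` under
`Û`, its jet and its original-time functional are the dictionary values
`X̂_s = -(x² D/X)(υ s)`, `exp(-∫₀ˢ 2/X̂²) = D(υ s)`, `∫₀ˢ (x² exp(-∫2/X̂²)/X̂²)² = υ s`. Then
`pointLocTime x x² n Û = Ŝ`. [cite: Lawler2005, §6.3] -/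
theorem pointLocTime_eq_of_dictionary (hx1 : 1 / level n < |x|) (hx2 : |x| < level n)
    {ω : ℝ≥0 → ℝ} {ρf Ŝ : ℝ≥0} (hρ : (ρf : WithTop ℝ≥0) = locTime x n ω) {Û : ℝ≥0 → ℝ}
    {υ : ℝ≥0 → ℝ≥0} (hυS : υ Ŝ = ρf) (hυlt : ∀ s, s < Ŝ → υ s < ρf)
    (hgap : ∀ s ≤ Ŝ, pointGap x s Û = -(x ^ 2 * D x n (υ s) ω / X x n (υ s) ω))
    (hderiv : ∀ s ≤ Ŝ, Real.exp (-∫ r in (0 : ℝ)..s, 2 / pointGap x r.toNNReal Û ^ 2) =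
      D x n (υ s) ω)
    (htime : ∀ s ≤ Ŝ, ∫ r in (0 : ℝ)..s, (x ^ 2 *
      Real.exp (-∫ r' in (0 : ℝ)..r, 2 / pointGap x r'.toNNReal Û ^ 2) /
        pointGap x r.toNNReal Û ^ 2) ^ 2 = υ s) :
    pointLocTime x (x ^ 2) n Û = Ŝ := by
  have hx := ne_zero_of_inv_level_lt hx1
  have hN : 0 < level n := by unfold level; positivity
  -- the three image quantities through the dictionary, for `s ≤ Ŝ`
  have hXband : ∀ s ≤ Ŝ, X x n (υ s) ω ∈ Icc (bandLo x n) (bandHi x n) := fun s _ ↦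
    X_mem_band hx1 hx2 _ ω
  have hcpos : ∀ s ≤ Ŝ, 0 < x ^ 2 * D x n (υ s) ω := fun s _ ↦
    mul_pos (by positivity) (Real.exp_pos _)
  have habsgap : ∀ s ≤ Ŝ, |pointGap x s Û| = x ^ 2 * D x n (υ s) ω / |X x n (υ s) ω| := by
    intro s hs
    rw [hgap s hs, abs_neg, abs_div, abs_of_pos (hcpos s hs)]
  have hratio : ∀ s ≤ Ŝ, x ^ 2 * Real.exp (-∫ r in (0 : ℝ)..s, 2 / pointGap x r.toNNReal Û ^ 2) /
      |pointGap x s Û| = |X x n (υ s) ω| := by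
    intro s hs
    rw [hderiv s hs, habsgap s hs]
    have hD : D x n (υ s) ω ≠ 0 := (Real.exp_pos _).ne'
    have hX : |X x n (υ s) ω| ≠ 0 := abs_ne_zero.2 (X_ne_zero hx1 hx2 _ ω)
    field_simp
  -- Part 1: `Ŝ ≤ pointLocTime`
  have hlow : ∀ s : ℝ≥0, s < Ŝ → (s : WithTop ℝ≥0) < pointLocTime x (x ^ 2) n Û := by
    intro s hs
    refine coe_lt_pointLocTime_of_forall hx1 hx2 (fun s' hs' ↦ ?_) (fun s' hs' ↦ ?_)
      (fun s' hs' ↦ ?_)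
    · have hs'S : s' ≤ Ŝ := hs'.trans hs.le
      have hlt : (υ s' : WithTop ℝ≥0) < locTime x n ω := by
        rw [← hρ]; exact WithTop.coe_lt_coe.2 (hυlt s' (hs'.trans_lt hs))
      obtain ⟨hb, hr, -⟩ := facts_of_coe_lt_locTime hlt
      rw [hgap s' hs'S]
      exact neg_div_mem_Ioo_band hx (hXband s' hs'S) hr
    · have hs'S : s' ≤ Ŝ := hs'.trans hs.le
      have hlt : (υ s' : WithTop ℝ≥0) < locTime x n ω := by
        rw [← hρ]; exact WithTop.coe_lt_coe.2 (hυlt s' (hs'.trans_lt hs))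
      obtain ⟨hb, -, -⟩ := facts_of_coe_lt_locTime hlt
      rw [hratio s' hs'S]
      exact abs_mem_Ioo_of_mem_Ioo_band hb
    · have hs'S : s' ≤ Ŝ := hs'.trans hs.le
      have hlt : (υ s' : WithTop ℝ≥0) < locTime x n ω := by
        rw [← hρ]; exact WithTop.coe_lt_coe.2 (hυlt s' (hs'.trans_lt hs))
      obtain ⟨-, -, hc⟩ := facts_of_coe_lt_locTime hlt
      rw [htime s' hs'S]
      exact hc
  have hSle : (Ŝ : WithTop ℝ≥0) ≤ pointLocTime x (x ^ 2) n Û := coe_le_of_forall_lt hlow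
  refine le_antisymm ?_ hSle
  -- Part 2: `pointLocTime ≤ Ŝ`
  -- the wide exit is `≥ Ŝ`, so at `Ŝ` the stopped / killed processes are raw
  have hwide : (Ŝ : WithTop ℝ≥0) ≤ pointWideExit x n Û := hSle.trans (min_le_left _ _)
  have hstopR : ∀ s : ℝ≥0, (s : WithTop ℝ≥0) ≤ pointWideExit x n Û →
      pointGapStop x n s Û = pointGap x s Û := fun s hs ↦ stoppedProcess_eq_of_le hs
  have hstop : pointGapStop x n Ŝ Û = pointGap x Ŝ Û := hstopR Ŝ hwide
  have hderivS : pointDeriv x n Ŝ Û =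
      Real.exp (-∫ r in (0 : ℝ)..Ŝ, 2 / pointGap x r.toNNReal Û ^ 2) := by
    unfold pointDeriv timeIntegral
    congr 2
    refine intervalIntegral.integral_congr fun r hr ↦ ?_
    rw [uIcc_of_le Ŝ.coe_nonneg] at hr
    have hr' : (r.toNNReal : WithTop ℝ≥0) ≤ pointWideExit x n Û :=
      (WithTop.coe_le_coe.2 (Real.toNNReal_le_iff_le_coe.2 hr.2)).trans hwide
    simp only [trunc_of_le hr', hstopR _ hr']
  have hderivR : ∀ r : ℝ, r ∈ Icc (0 : ℝ) Ŝ → pointDeriv x n r.toNNReal Û =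
      Real.exp (-∫ r' in (0 : ℝ)..r, 2 / pointGap x r'.toNNReal Û ^ 2) := by
    intro r hr
    unfold pointDeriv timeIntegral
    rw [Real.coe_toNNReal _ hr.1]
    congr 2
    refine intervalIntegral.integral_congr fun r' hr' ↦ ?_
    rw [uIcc_of_le hr.1] at hr'
    have h' : (r'.toNNReal : WithTop ℝ≥0) ≤ pointWideExit x n Û :=
      (WithTop.coe_le_coe.2 (Real.toNNReal_le_iff_le_coe.2 (hr'.2.trans hr.2))).trans hwide
    simp only [trunc_of_le h', hstopR _ h']
  have htimeS : pointTime x (x ^ 2) n Ŝ Û = ∫ r in (0 : ℝ)..Ŝ, (x ^ 2 *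
      Real.exp (-∫ r' in (0 : ℝ)..r, 2 / pointGap x r'.toNNReal Û ^ 2) /
        pointGap x r.toNNReal Û ^ 2) ^ 2 := by
    unfold pointTime timeIntegral
    refine intervalIntegral.integral_congr fun r hr ↦ ?_
    rw [uIcc_of_le Ŝ.coe_nonneg] at hr
    have hr' : (r.toNNReal : WithTop ℝ≥0) ≤ pointWideExit x n Û :=
      (WithTop.coe_le_coe.2 (Real.toNNReal_le_iff_le_coe.2 hr.2)).trans hwide
    simp only [trunc_of_le hr', hstopR _ hr', hderivR r hr]
  have hloc : locTime x n ω = min (gapExit x n ω) (min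
      (Process.exitTime (ratioPre x n) (1 / level n) (level n) ω) (((n : ℝ≥0) + 1 : ℝ≥0) :
        WithTop ℝ≥0)) := rfl
  -- which of the three original exits is `ρ`?
  rcases min_choice (gapExit x n ω) (min (Process.exitTime (ratioPre x n) (1 / level n) (level n) ω)
      (((n : ℝ≥0) + 1 : ℝ≥0) : WithTop ℝ≥0)) with hcase | hcase
  · -- `ρ = gapExit`: the gap sits at an endpoint, so the image RATIO has left `(1/N, N)`
    have hE : gapExit x n ω = ρf := by rw [hρ, hloc]; exact hcase.symm
    have hout := Process.notMem_Ioo_of_exitTime_eq_coe (continuous_gap hx ω) hE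
    have hXeq : X x n ρf ω = gap x ρf ω := X_eq_gap_of_le (by rw [hρ])
    have habs : |X x n ρf ω| ∉ Ioo (1 / level n) (level n) := by
      rw [hXeq]; exact abs_notMem_Ioo_of_notMem_Ioo_band (hXeq ▸ X_mem_band hx1 hx2 ρf ω) hout
    have hval : pointRatio x (x ^ 2) n Ŝ Û ∉ Ioo (1 / level n) (level n) := by
      unfold pointRatio
      rw [hderivS, hstop, hratio Ŝ le_rfl, hυS]
      exact habs
    calc pointLocTime x (x ^ 2) n Û
        ≤ Process.exitTime (pointRatio x (x ^ 2) n) (1 / level n) (level n) Û :=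
          (min_le_right _ _).trans ((min_le_right _ _).trans (min_le_left _ _))
      _ ≤ Ŝ := (Process.exitTime_le_coe_iff (continuous_pointRatio hx1 hx2 Û)).2 ⟨Ŝ, le_rfl, hval⟩
  · have hρ2 : (ρf : WithTop ℝ≥0) = min (Process.exitTime (ratioPre x n) (1 / level n) (level n) ω)
        (((n : ℝ≥0) + 1 : ℝ≥0) : WithTop ℝ≥0) := by rw [hρ, hloc, hcase]
    rcases min_choice (Process.exitTime (ratioPre x n) (1 / level n) (level n) ω)
        (((n : ℝ≥0) + 1 : ℝ≥0) : WithTop ℝ≥0) with hcase' | hcase'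
    · -- `ρ = ratioExit`: the original ratio sits at an endpoint, so the image GAP left its band
      have hE : Process.exitTime (ratioPre x n) (1 / level n) (level n) ω = ρf := by
        rw [hρ2]; exact hcase'.symm
      have hout := Process.notMem_Ioo_of_exitTime_eq_coe (continuous_ratioPre hx1 hx2 ω) hE
      rw [ratioPre_eq_of_le hρ.le] at hout
      have hval : pointGapStop x n Ŝ Û ∉ Ioo (bandLo (-x) n) (bandHi (-x) n) := by
        rw [hstop]
        intro hmem
        have h1 := abs_mem_Ioo_of_mem_Ioo_band hmem
        rw [habsgap Ŝ le_rfl, hυS] at h1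
        exact hout h1
      calc pointLocTime x (x ^ 2) n Û
          ≤ Process.exitTime (pointGapStop x n) (bandLo (-x) n) (bandHi (-x) n) Û :=
            (min_le_right _ _).trans (min_le_left _ _)
        _ ≤ Ŝ := (Process.exitTime_le_coe_iff (continuous_pointGapStop hx Û)).2 ⟨Ŝ, le_rfl, hval⟩
    · -- `ρ = N`: the original TIME is up
      have hE : ρf = (n : ℝ≥0) + 1 := by
        apply WithTop.coe_injective; rw [hρ2, hcase']
      have hval : pointTime x (x ^ 2) n Ŝ Û ∉ Ioo (-1 : ℝ) (level n) := by
        rw [htimeS, htime Ŝ le_rfl, hυS, hE, coe_cap]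
        exact fun h ↦ lt_irrefl _ h.2
      calc pointLocTime x (x ^ 2) n Û
          ≤ Process.exitTime (pointTime x (x ^ 2) n) (-1) (level n) Û :=
            (min_le_right _ _).trans ((min_le_right _ _).trans (min_le_right _ _))
        _ ≤ Ŝ := (Process.exitTime_le_coe_iff (continuous_pointTime hx1 hx2 Û)).2 ⟨Ŝ, le_rfl, hval⟩

end SLESixMoebius

end Literature.Probability.RandomPlanarGeometry

end
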